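import Literature.NumberTheory.Automorphic.JacquetNonzeroEmbedsNormalizedInd         -- ★ p829038 (brick A): `exists_character_quotient_injective_intertwiningMap_normalizedInd`
import Literature.NumberTheory.Automorphic.JacquetLineQuotientCharacter              -- ★ p830989: `Representation.embeds_or_embeds_of_isConstituentOf_of_line` (generic N2 core)
import Literature.NumberTheory.Automorphic.U3PrincipalSeriesLettersUnfold            -- ★ p829690: `U3PrincipalSeriesConstituentEmbeds_iff` (N2 ★ `U3PrincipalSeriesConstituentEmbeds`, theorem-world)
import Literature.NumberTheory.Automorphic.U3PrincipalSeriesJacquetFiltrationFullUnfold  -- ★ p831282: `U3PrincipalSeriesJacquetFiltration_iff` (N1, theorem-world, incl. the `wχ`-line)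
import Literature.NumberTheory.Automorphic.U3JacquetVanishingSupercuspidal        -- ★ `Rogawski1990.u3_isSupercuspidal_iff_jacquet_eq_zero_holds` (the letter N6 IS a theorem)
import Summits.HodgeConjecture.HodgeConjecture.Theorems.F0P2pCmPrincipalSeriesInterface  -- ★ `not_subsingleton_coinvariants_of_isConstituentOf_cmPrincipalSeries` (N6 ⇒ `r_B ≠ 0` on constituents)
import HarnessLib

/-!
# Crux `H413` — N2 JUNCTION: `U3PrincipalSeriesConstituentEmbeds L` (every constituent of `i_G(χ)` embeds into `i_G(χ)` or `i_G(wχ)`)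
# FROM N1 (the Jacquet filtration of `i_G(χ)`) ALONE — the non-vanishing of `r_B` on constituents comes from the ★ theorem N6

Cell `hodgecm-mathlib`, F0∕P3 «U3-mult», crux item stmt-HodgeConjecture-24833 (`HCCMUnconditional.H413`); the Keys pay-down line
`Cruxes/H413/Lines/F0_P3_KeysCaseTwoPaydown.lean` ED. 1 (`stub_constituentEmbeds` = N2 ★ `UnitaryGroup.U3PrincipalSeriesConstituentEmbeds L`
[Casselman1995 Cor. 6.3.9 (b)], consumed by J1 ★ `u3PrincipalSeriesLengthLeTwo_of_embeds`).  Seat F0P3-p01 (g10); `--supports stmt-HodgeConjecture-24833`;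
theorems only — no `def`, no new named fact, no instance, no notation, no `sorry`.  HONEST LABEL: HC_CM is proved only modulo the printed
citations until rung 0 closes.  This junction DERIVES the letter N2 from the letter N1 ★ `U3PrincipalSeriesJacquetFiltration` [Casselman1995
Lemma 7.1.1 (a)] (hypothesis BY NAME, in-house assembler in flight) and in-house ★ theorems — among them the former letter N6 ★
`Rogawski1990.u3_isSupercuspidal_iff_jacquet_eq_zero`, now the ★ theorem `u3_isSupercuspidal_iff_jacquet_eq_zero_holds` (Harish-Chandra's criterion
for `U(3)(L⁺_v)` at every non-split place); it changes no `sorry` count by itself (the Keys pay-down line's `stub_constituentEmbeds` becomes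
`u3PrincipalSeriesConstituentEmbeds_of_jacquetFiltration L (stub_jacquetFiltration L)`).

THE MATHEMATICS ([Casselman1995] proof of Cor. 6.3.9; [BernsteinZelevinsky1977] Thm. 2.4 (b)).  Let `c = ⟦r⟧ ≅ V₁ ⁄ V₂` be a constituent of
`I = i_G(χ)`, `χ = (χ₁, χ₂)`, at a non-split place `v` (`G = U(Φ₃)(L⁺_v)`, `B = TN` its Borel).  (i) `r_B(r) ≠ 0`: otherwise `r` is supercuspidal
(★ N6, `⇐`, Harish-Chandra), hence splits off and embeds into `I`, contradicting Frobenius reciprocity — ★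
`F0P2pCmPrincipalSeriesInterface.not_subsingleton_coinvariants_of_isConstituentOf_cmPrincipalSeries` fed with ★ `…_holds`.  (ii) Brick A (★
`exists_character_quotient_injective_intertwiningMap_normalizedInd`, Jacquet's lemma at the CM Borel triple: `G = B·K_v`, `δ_B|_N = 1`, `T` abelian,
second countability): `r_B(r)` has an irreducible — one-dimensional — quotient `ℂ_θ` and `r ↪ i_G(θ)`.  (iii) The generic core ★
`Representation.embeds_or_embeds_of_isConstituentOf_of_line`: the non-zero `T`-map `r_B(V₁) ↠ r_B(r) → ℂ_θ` and the injection `r_B(V₁) ↪ r_B(I)`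
(exactness of `r_B`) read `θ` off N1's line `ℓ ⊂ r_B(I)` (`T` acts by `wχ` on `ℓ`, by `χ` on `r_B(I)/ℓ`): `θ = χ` or `θ = wχ`.  Hence `r ↪ i_G(χ)` or
`r ↪ i_G(wχ)`.

ELABORATION (measured, scratch legs `D1–D6` of this seat, 2026-08-31): N1 and N2 are `def … : Prop` letters whose bodies carry private `_proof_k`
aux constants (the cell's finding of record, director s645); feeding the def-world `hN1 v …` to the generic core's `hline` binder does not unify
within 1.2·10⁷ heartbeats (diagnostics: `adicCompletion.equivCompletion` unfolded 9·10⁴×), while every other argument elaborates at default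
heartbeats.  This file therefore never meets a `def` body: it enters N2 through ★ `U3PrincipalSeriesConstituentEmbeds_iff` (p829690) and reads N1
through ★ `U3PrincipalSeriesJacquetFiltration_iff` (p831282) — theorem-world throughout; the `rfl`-bridge `cmPrincipalSeries L 3 v θ =
normalizedInd (cmBorelTriple L 3 v) (𝟙 ⊗ θ)` is crossed by `exact` as in ★ brick A's CM section.

References: [Casselman1995] Lemma 7.1.1 (a) p. 67, Cor. 6.3.9 p. 60, Prop. 3.2.3; [BernsteinZelevinsky1977] Prop. 1.9 (a)(b), §2.3, Thm. 2.4 (b);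
[Rogawski1990] §12.1 pp. 171–172, §12.2 p. 173.
-/

set_option autoImplicit false
-- the mandated namespace repeats `HodgeConjecture.HodgeConjecture`, as in every `Theorems/*.lean` of this sub-problem
set_option linter.dupNamespace false

noncomputable section

open NumberField IsDedekindDomain
open Literature.NumberTheory Literature.NumberTheory.Automorphic Literature.NumberTheory.Automorphic.UnitaryGroup
open scoped Matrix

namespace Summit.HodgeConjecture.HodgeConjecture.Cruxes.H413.F0P3U3ConstituentEmbedsOfJacquet

variable (L : Type) [Field L] [NumberField L] [IsCMField L]

/-! ## §1 N2 from N1 and the non-vanishing of the Jacquet modules of the constituents -/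

set_option synthInstance.maxHeartbeats 400000 in  -- instance paths on the CM carrier `∏_{w ∣ v} L_w` (as in ★ N1's statement file)
set_option maxHeartbeats 2000000 in  -- the STATEMENT of `hNC` at the carrier (as ★ N1 ∕ N2 themselves); the proof is theorem-world
/-- **N2 JUNCTION, `r_B ≠ 0` form — `U3PrincipalSeriesConstituentEmbeds L` from N1 ★ `U3PrincipalSeriesJacquetFiltration L` and the
non-vanishing of the Jacquet module of every constituent of every `i_G(χ₁, χ₂)` at the non-split places (`hNC`, [Casselman1995 Cor. 6.3.9 (b)]).**
For a constituent `c = ⟦r⟧` of `i_G(χ)`: brick A gives a quotient character `θ` of `r_B(r) ≠ 0` with `r ↪ i_G(θ)`, and the generic core reads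
`θ ∈ {χ, wχ}` off N1's line.  Theorem-world via the two ★ `_iff` bridges (module docstring).
[cite: Casselman1995, Cor. 6.3.9 p. 60; Lemma 7.1.1 (a) p. 67] [cite: BernsteinZelevinsky1977, Prop. 1.9 (a)(b), Thm. 2.4 (b)] [cite: Rogawski1990, §12.1 pp. 171–172] -/
theorem u3PrincipalSeriesConstituentEmbeds_of_jacquetFiltration_of_nontrivial (hN1 : U3PrincipalSeriesJacquetFiltration L)
    (hNC : ∀ (v : HeightOneSpectrum (𝓞 ↥(maximalRealSubfield L))),
      (∀ w : PlacesOver L v, IsCMField.complexConj L • w.1 = w.1) →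
      ∀ (χ₁ : (LocalRing L v)ˣ →* ℂˣ) (χ₂ : ↥(normOneUnits (conjLocal L (IsCMField.complexConj L) v)) →* ℂˣ),
        Continuous (fun x => ((χ₁ x : ℂˣ) : ℂ)) → Continuous (fun x => ((χ₂ x : ℂˣ) : ℂ)) →
      ∀ r : SmoothIrrep ↥(unitaryGroupOfForm (conjLocal L (IsCMField.complexConj L) v) (cmLocalForm L 3 v)),
        (IrrClass.mk r).IsConstituentOf (cmPrincipalSeries L 3 v (cmTorusCharPair L v χ₁ χ₂)) →
        Nontrivial ((cmBorelTriple L 3 v).restrict r.ρ).Coinvariants) :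
    U3PrincipalSeriesConstituentEmbeds L := by
  refine (U3PrincipalSeriesConstituentEmbeds_iff L).2 fun v hns χ₁ χ₂ hc₁ hc₂ c hc => ?_
  -- N1 at `(v, χ₁, χ₂)`, theorem-world (★ p831282)
  have hline := (U3PrincipalSeriesJacquetFiltration_iff L).1 hN1 v hns χ₁ χ₂ hc₁ hc₂
  -- the constituent's representative
  obtain ⟨r, hrc, -⟩ := id hc
  subst hrc
  haveI := locallyCompactSpace_cmBorelU L 3 v
  haveI := r.isIrreducible
  haveI : Nontrivial ((cmBorelTriple L 3 v).restrict r.ρ).Coinvariants := hNC v hns χ₁ χ₂ hc₁ hc₂ r hc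
  -- brick A at the CM Borel triple: a quotient character `θ` of `r_B(r)` and `r ↪ normalizedInd B (𝟙 ⊗ θ)`
  have hK := isCompact_isOpen_cmLocalIntegralLevel L 3 (Matrix.of fun i j : Fin 3 => if i.val + j.val + 1 = 3 then (1 : L) else 0) v
  have hA := r.ρ.exists_character_quotient_injective_intertwiningMap_normalizedInd (cmBorelTriple L 3 v) r.isSmooth
    (countable_quotient_of_isOpen_cmLocal L 3 v) (deltaChar_cmBorelTriple_eq_one_of_mem_N L 3 v) hK.1
    (exists_borel_mul_mem_cmLocalIntegralLevel L 3 v) (torusU_mul_comm _ _)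
  refine ⟨r, rfl, ?_⟩
  -- the generic core; the conclusion crosses the `rfl`-bridge `normalizedInd B (𝟙 ⊗ θ) = cmPrincipalSeries L 3 v θ` (θ = χ, wχ)
  exact Representation.embeds_or_embeds_of_isConstituentOf_of_line (cmBorelTriple L 3 v) (isLimitOfCompactOpen_cmBorelTriple_N L 3 v)
    (cmPrincipalSeries L 3 v (cmTorusCharPair L v χ₁ χ₂))
    (isAdmissible_cmPrincipalSeries_of_iwasawa L 3 v (exists_borel_mul_mem_cmLocalIntegralLevel L 3 v) (cmTorusCharPair L v χ₁ χ₂)).isSmooth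
    (cmTorusCharPair L v χ₁ χ₂) (cmWeylTorusCharPair L v χ₁ χ₂) hline r hc hA

/-! ## §2 N2 from N1 alone -/

set_option synthInstance.maxHeartbeats 400000 in
set_option maxHeartbeats 2000000 in
/-- **N2 JUNCTION — `U3PrincipalSeriesConstituentEmbeds L` from the letter N1 ★ `U3PrincipalSeriesJacquetFiltration L` (BY NAME) alone.**
The `r_B ≠ 0` input of §1 is ★ `F0P2pCmPrincipalSeriesInterface.not_subsingleton_coinvariants_of_isConstituentOf_cmPrincipalSeries` fed with the ★
THEOREM `Rogawski1990.u3_isSupercuspidal_iff_jacquet_eq_zero_holds` (Harish-Chandra's criterion for `U(3)(L⁺_v)`, every non-split `v`): a constituent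
with `r_B = 0` would be supercuspidal, hence split off and embed into `i_G(χ)`, contradicting Frobenius reciprocity.  With this the Keys pay-down
line's `stub_constituentEmbeds` is `u3PrincipalSeriesConstituentEmbeds_of_jacquetFiltration L (stub_jacquetFiltration L)`.
[cite: Casselman1995, Cor. 6.3.9 p. 60; Lemma 7.1.1 (a) p. 67; Thm. 5.3.1] [cite: BernsteinZelevinsky1977, Thm. 2.4 (b)] [cite: Rogawski1990, §12.2 p. 173] -/
theorem u3PrincipalSeriesConstituentEmbeds_of_jacquetFiltration (hN1 : U3PrincipalSeriesJacquetFiltration L) :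
    U3PrincipalSeriesConstituentEmbeds L :=
  u3PrincipalSeriesConstituentEmbeds_of_jacquetFiltration_of_nontrivial L hN1 fun v hns χ₁ χ₂ _ _ r hc =>
    not_subsingleton_iff_nontrivial.1 fun h0 =>
      F0P2pCmPrincipalSeriesInterface.not_subsingleton_coinvariants_of_isConstituentOf_cmPrincipalSeries L v
        Rogawski1990.u3_isSupercuspidal_iff_jacquet_eq_zero_holds hns (cmTorusCharPair L v χ₁ χ₂) r hc h0

end Summit.HodgeConjecture.HodgeConjecture.Cruxes.H413.F0P3U3ConstituentEmbedsOfJacquet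

end
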